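import Literature.Probability.RandomPlanarGeometry.HexSAWSurfaceWallRenewalWallOrder
import HarnessLib

/-!
# Column coverage below the wall, and the cuts of an irreducible positive wall bridge

Self-avoiding walk on the honeycomb lattice in the brick-wall frame (`brickWallGraph`), half-plane `Y ≤ 0`.  For an
IRREDUCIBLE POSITIVE WALL BRIDGE `ω ∈ ipwb n` (a wall bridge `wbr n` — brick-wall SAW from `(0,0)`, `Y_i ≤ 0`, `n` even,
`Y_n = 0`, `0 ≤ X_i ≤ X_n` — which is a bridge, `0 < X_i ≤ X_n` for `i ≥ 1`, with no wall-renewal time in `[1, n)`)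
this module proves the any-length structure facts about COLUMNS and CUTS that the slack-`2j` classifications use as
shields and separators.  Index the unit cuts `x = c + 1/2` by `c ∈ [0, X_n)`; a horizontal step crosses exactly one
cut, `c = min (X_t, X_{t+1})`; «crossed below the wall» means crossed by a horizontal step `t` with `Y_{t+1} = Y_t < 0`.

* `exists_subwall_at` — COLUMN COVERAGE (ipwb): every column `g` with `2 ≤ g ≤ X_n − 1` carries a point of the walk
  strictly below the wall; `exists_subwall_le_two` — some point strictly below the wall has column `≤ 2` (`n ≥ 4`).
  This is where irreducibility enters: the first passage at column `g` is either below the wall, or at the wall point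
  `(g, 0)` — then (`g` even) it is a visit left along the wall and non-renewal (`exists_return_of_visit`) forces a later
  return to a column `≤ g`, through column `g` below the wall since `(g, 0)` is taken; or (`g` odd) the walk came from
  the visit `(g − 1, 0)`, non-renewal there forces a return to a column `≤ g − 1`, and the left step achieving it
  starts below the wall in column `g` (from `(g, 0)` the walk steps right or down, `step_from_wall`).
* `exists_subwall_crossing_of_unused` — a cut carrying no wall step is crossed below the wall (every wall bridge);
  `exists_two_subwall_crossings_of_used` — a cut carrying a wall step and crossed below the wall at all is crossed
  there by a left AND by a right step (two right crossings are separated by a left one, `exists_descent`; a left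
  crossing is flanked by two right ones, at most one of which is the wall step; `(c, 0)` is visited once).
* `le_apply_of_no_subwall_crossing` — BODIES DO NOT STRADDLE AN UNCROSSED CUT: if the cut `c + 1/2` is not crossed
  below the wall, an excursion off the wall containing a point of column `c + 1` stays in the columns `≥ c + 1`;
  `findGreatest_wall_spec` — the last wall time before a time strictly below the wall is a dive, followed by no wall
  point up to that time.
* `card_uncrossed_cuts_add_one_le_card_dives` — SEPARATING CUTS ARE FEW (ipwb, `n ≥ 4`): the cuts `c + 1/2`,
  `2 ≤ c ≤ X_n − 2`, NOT crossed below the wall number at most `r − 1`, `r` the number of dives: by column coverage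
  the column `c + 1` carries a sub-wall point, the last wall time before it is a dive `d_c`, the excursion after `d_c`
  attains column `c + 1` and stays right of the cut, so `c ↦ d_c` is injective — and it misses the dive preceding a
  sub-wall point of column `≤ 2`.
* tools for every brick-wall walk / wall bridge: `exists_ascent` (discrete intermediate value, upward; the mirror of
  `exists_descent`), `apply_one_eq_of_apply_zero_ne`, `apply_zero_succ_of_apply_one_eq`, `exists_first_passage`,
  `exists_return_of_visit` (ipwb: non-renewal at a visit, unfolded), `card_stepsR_add_card_stepsL_eq` (step
  bookkeeping `#R + #L = 2·visits + #{horizontal steps below the wall}`, with `card_wallSteps_eq_two_mul_visits`).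

CUT COUNTING (remark, not restated as a theorem).  Summing over the cuts — unused cuts crossed below the wall once,
used cuts crossed below the wall twice except at most `(r − 1) + 3` of them — gives
`#{horizontal steps below the wall} ≥ X_n + 2v − 2r − 4 ≥ 4v − 4` by `2v + 2r ≤ X_n`
(`two_mul_visits_add_two_mul_card_dives_le_apply` of `HexSAWSurfaceWallRenewalWallOrder`), i.e. an independent proof
of the tree's `two_mul_card_stepsD_add_six_mul_visits_le` (`2·#D + 6v ≤ n + 4`, `HexSAWSurfaceWallRenewalIteratedGap`,
proved there by the iterated gap); the present module does not restate that bound.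

STATUS: lane tools of the a-idea-1 bridge/renewal lineage (cars 71 `…SixStep`, 73 `…SixStepRigid`, 76 `…WallOrder`,
79a/79b `…SlackFourBumpHairpin` / `…SlackFourDoubleDip`); imports only `HexSAWSurfaceWallRenewalWallOrder`; the module
introduces no definition.  OURS (new in writing, elementary): all statements above; checked against the enumeration
of all wall bridges of length `n ≤ 22` from the tree's definitions (`#ipwb(n)` = 1, 0, 1, 1, 3, 7, 18, 49, 133, 373,
1 066 for `n = 2, …, 22`, the tree's census): column coverage, the separating-cut count, the two crossing statements
and the bookkeeping identity fail on NO block (the separating-cut count is an equality on every block of length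
`≤ 18` and on all but `2` resp. `12` blocks of length `20` resp. `22`); coverage FAILS on positive wall bridges that
are reducible (`2 107` of the `3 206` positive wall bridges of length `22`; first `RRRR`), so irreducibility is
essential.  The printed sources carry the
set-up only (Madras–Slade §1.2, Definition 1.2.4 (bridges, p. 11); §3.1, Definition 3.1.2 (half-space walks, p. 58);
§4.2, Definition 4.2.1 (irreducible bridges, p. 90); Hammersley–Torrie–Whittington §2 (walks attached to a surface);
Enting–Jensen §7.4.2, Fig. 7.10 (brickwork frame); Beaton et al. §3.1 (surface visits)) — none states these lemmas.
No `set_option` line is used.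
-/

namespace Literature.Probability.RandomPlanarGeometry.SAW.HexBW.Wall

open Finset
open Literature.Probability.LatticeModels Literature.Probability.Percolation SimpleGraph

variable {n : ℕ} {ω : ℕ → Site 2}

/-- Extensionality for sites of `ℤ²` from the two coordinates (plumbing). [folklore] -/
private theorem site_ext_vb {p q : Site 2} (h0 : p 0 = q 0) (h1 : p 1 = q 1) : p = q := by
  funext k; fin_cases k
  · exact h0
  · exact h1

/-! ## §1 Walking lemmas: ascents, horizontal steps, first passages, non-renewal unfolded -/

/-- **Discrete ascent**: if `X_a ≤ c < X_b` with `a < b ≤ n`, some step `i ∈ [a, b)` goes from column `c` to column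
`c + 1` (steps change `X` by at most one). Mirror image of `exists_descent`.
[cite: MadrasSlade1993, §1.2 (walks as nearest-neighbour vertex functions)] -/
theorem exists_ascent (hbw : IsBW n ω) {a b : ℕ} {c : ℤ} (hab : a < b) (hbn : b ≤ n) (ha : ω a 0 ≤ c)
    (hb : c < ω b 0) : ∃ i, a ≤ i ∧ i < b ∧ ω i 0 = c ∧ ω (i + 1) 0 = c + 1 := by
  classical
  have hex : ∃ s, a < s ∧ s ≤ b ∧ c < ω s 0 := ⟨b, hab, le_rfl, hb⟩
  obtain ⟨hs1, hs2, hs3⟩ := Nat.find_spec hex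
  set s := Nat.find hex with hs
  have hi : ω (s - 1) 0 ≤ c := by
    rcases eq_or_lt_of_le (show a ≤ s - 1 by omega) with h | h
    · rw [← h]; exact ha
    · have := Nat.find_min hex (show s - 1 < s by omega)
      rw [not_and, not_and, not_lt] at this
      exact this h (by omega)
  have hstep := abs_sub_apply_zero_le_one (hbw (s - 1) (by omega))
  rw [show s - 1 + 1 = s by omega, abs_le] at hstep
  exact ⟨s - 1, by omega, by omega, by omega, by rw [show s - 1 + 1 = s by omega]; omega⟩

/-- A step that changes the column is horizontal: the height is unchanged.
[cite: EntingJensen2009, §7.4.2, Fig. 7.10 (brickwork form of the honeycomb lattice)] -/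
theorem apply_one_eq_of_apply_zero_ne (hbw : IsBW n ω) {i : ℕ} (hi : i < n) (hx : ω (i + 1) 0 ≠ ω i 0) :
    ω (i + 1) 1 = ω i 1 := by
  rcases step_cases hbw hi with ⟨-, hy⟩ | ⟨-, hy⟩ | ⟨hx', -⟩ | ⟨hx', -⟩
  · exact hy
  · exact hy
  · exact absurd hx' hx
  · exact absurd hx' hx

/-- A horizontal step changes the column by one: `X_{i+1} = X_i + 1` or `X_{i+1} = X_i − 1`.
[cite: EntingJensen2009, §7.4.2, Fig. 7.10 (brickwork form of the honeycomb lattice)] -/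
theorem apply_zero_succ_of_apply_one_eq (hbw : IsBW n ω) {i : ℕ} (hi : i < n) (hy : ω (i + 1) 1 = ω i 1) :
    ω (i + 1) 0 = ω i 0 + 1 ∨ ω (i + 1) 0 = ω i 0 - 1 := by
  rcases step_cases hbw hi with ⟨hx, -⟩ | ⟨hx, -⟩ | ⟨-, hy'⟩ | ⟨-, hy'⟩
  · exact Or.inl hx
  · exact Or.inr hx
  · rw [hy'] at hy; omega
  · rw [hy'] at hy; omega

/-- **Non-renewal, unfolded.** In an irreducible positive wall bridge, a visit time `t ∈ [1, n)` whose past stays in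
the columns `≤ X_t` is followed by a return to a column `≤ X_t` (otherwise `t` would be a wall-renewal time).
[cite: MadrasSlade1993, §4.2, Definition 4.2.1 (irreducible bridges);
BeatonBousquetMelouDeGierDuminilCopinGuttmann2014, §3.1 (arXiv v5 p. 8)] -/
theorem exists_return_of_visit (hω : ω ∈ ipwb n) {t : ℕ} (ht1 : 1 ≤ t) (htn : t < n) (ht2 : t % 2 = 0)
    (hY : ω t 1 = 0) (hhead : ∀ i, i ≤ t → ω i 0 ≤ ω t 0) : ∃ u, t < u ∧ u ≤ n ∧ ω u 0 ≤ ω t 0 := by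
  obtain ⟨hp, -, hirr⟩ := mem_ipwb.1 hω
  obtain ⟨-, hb⟩ := mem_pwb.1 hp
  by_contra hcon
  refine hirr t ht1 htn ⟨⟨htn.le, fun i h1 h2 => ⟨(hb i h1 (by omega)).1, hhead i h2⟩,
    fun j h1 h2 => ⟨?_, ?_⟩⟩, ht2, hY⟩
  · have hlt : ω t 0 < ω (t + j) 0 := not_le.1 fun h => hcon ⟨t + j, by omega, by omega, h⟩
    simpa only [Nat.add_zero] using hlt
  · simpa only [show t + (n - t) = n by omega] using (hb (t + j) (by omega) (by omega)).2

/-- **First passage at a column**: for `0 < g ≤ X_n` there is a first time `τ ≤ n` with `X_τ = g`; before it the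
walk is strictly left of column `g`. [cite: MadrasSlade1993, §1.2] -/
theorem exists_first_passage (hw : ω ∈ wbr n) {g : ℤ} (hg0 : 0 < g) (hgX : g ≤ ω n 0) :
    ∃ τ, τ ≤ n ∧ ω τ 0 = g ∧ ∀ t < τ, ω t 0 < g := by
  classical
  obtain ⟨ha, -⟩ := mem_wbr.1 hw
  obtain ⟨hh, -, -⟩ := mem_archs.1 ha
  obtain ⟨hs, -⟩ := mem_hpw.1 hh
  obtain ⟨h0, -, hbw, -⟩ := mem_saws_iff.1 hs
  have hX0 : ω 0 0 = 0 := by rw [h0]; rfl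
  have hex : ∃ τ, τ ≤ n ∧ g ≤ ω τ 0 := ⟨n, le_rfl, hgX⟩
  obtain ⟨hτn, hτg⟩ := Nat.find_spec hex
  set τ := Nat.find hex with hτ
  have hlt : ∀ t < τ, ω t 0 < g := fun t ht => by
    have := Nat.find_min hex ht
    rw [not_and, not_le] at this
    exact this (by omega)
  refine ⟨τ, hτn, le_antisymm ?_ hτg, hlt⟩
  have hτ0 : τ ≠ 0 := fun h => by rw [h, hX0] at hτg; omega
  have hprev := hlt (τ - 1) (by omega)
  have hstep := abs_sub_apply_zero_le_one (hbw (τ - 1) (by omega))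
  rw [show τ - 1 + 1 = τ by omega, abs_le] at hstep
  omega

/-! ## §2 Column coverage below the wall -/

/-- **COLUMN COVERAGE BELOW THE WALL.** In an irreducible positive wall bridge every column `g` with `2 ≤ g ≤ X_n − 1`
carries a point of the walk strictly below the wall.  (Take the first passage `τ` at column `g`.  If `(g, 0)` is a
wall point: for `g` even it is a visit, left to the right along the wall, and non-renewal forces a later return to a
column `≤ g`, which passes through column `g` below the wall since `(g,0)` is taken; for `g` odd the walk came from
the visit `(g−1, 0)`, non-renewal at that visit forces a later return to a column `≤ g−1`, and the left step into
column `g − 1` starts at a sub-wall point of column `g`, as the wall point `(g,0)` is left rightwards or downwards.)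
[cite: MadrasSlade1993, §4.2, Definition 4.2.1 (irreducible bridges), §3.1, Definition 3.1.2 (half-space walks);
BeatonBousquetMelouDeGierDuminilCopinGuttmann2014, §3.1 (arXiv v5 p. 8: surface visits)] -/
theorem exists_subwall_at (hω : ω ∈ ipwb n) {g : ℤ} (hg2 : 2 ≤ g) (hgX : g + 1 ≤ ω n 0) :
    ∃ s, s ≤ n ∧ ω s 1 < 0 ∧ ω s 0 = g := by
  obtain ⟨hp, hn1, hirr⟩ := mem_ipwb.1 hω
  obtain ⟨hw, hb⟩ := mem_pwb.1 hp
  obtain ⟨ha, hwb⟩ := mem_wbr.1 hw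
  obtain ⟨hh, hn2, hYn⟩ := mem_archs.1 ha
  obtain ⟨hs, hhp⟩ := mem_hpw.1 hh
  obtain ⟨h0, -, hbw, hinj⟩ := mem_saws_iff.1 hs
  have hX0 : ω 0 0 = 0 := by rw [h0]; rfl
  obtain ⟨τ, hτn, hτg, hlt⟩ := exists_first_passage hw (show 0 < g by omega) (by omega)
  by_cases hYτ : ω τ 1 < 0
  · exact ⟨τ, hτn, hYτ, hτg⟩
  have hYτ0 : ω τ 1 = 0 := le_antisymm (hhp τ hτn) (not_lt.1 hYτ)
  have hτ1 : 1 ≤ τ := by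
    by_contra h
    have : τ = 0 := by omega
    rw [this, hX0] at hτg; omega
  have hτn' : τ < n := lt_of_le_of_ne hτn fun h => by rw [h] at hτg; omega
  have hpar := parity_apply hs hτn
  rw [hτg, hYτ0, add_zero] at hpar
  rcases Int.emod_two_eq_zero_or_one g with hge | hgo
  · -- `g` even: `τ` is a visit time
    have hτ2 : τ % 2 = 0 := by omega
    obtain ⟨u, hτu, hun, hXu⟩ := exists_return_of_visit hω hτ1 hτn' hτ2 hYτ0 fun i hi => by
      rcases eq_or_lt_of_le hi with h | h
      · rw [h]
      · rw [hτg]; exact (hlt i h).le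
    obtain ⟨hx1, -⟩ := step_from_visit_to_right hw hτn' hτ2 hYτ0
    rw [hτg] at hXu hx1
    have hu2 : τ + 1 < u := by
      by_contra h
      have : u = τ + 1 := by omega
      rw [this, hx1] at hXu; omega
    obtain ⟨i, hi1, hiu, -, hXi1⟩ := exists_descent hbw hu2 hun (c := g) (by rw [hx1]; omega) hXu
    refine ⟨i + 1, by omega, lt_of_le_of_ne (hhp (i + 1) (by omega)) fun hY => ?_, hXi1⟩
    have := hinj (show i + 1 ∈ {m | m ≤ n} by simp; omega) (show τ ∈ {m | m ≤ n} from hτn)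
      (site_ext_vb (by rw [hXi1, hτg]) (by rw [hY, hYτ0]))
    omega
  · -- `g` odd: the walk came from the visit `(g − 1, 0)` at time `τ − 1`
    have hprev := hlt (τ - 1) (by omega)
    have hstep := abs_sub_apply_zero_le_one (hbw (τ - 1) (by omega))
    rw [show τ - 1 + 1 = τ by omega, abs_le] at hstep
    have hXp : ω (τ - 1) 0 = g - 1 := by omega
    have hYp : ω (τ - 1) 1 = 0 := by
      have := apply_one_eq_of_apply_zero_ne hbw (show τ - 1 < n by omega)
        (by rw [show τ - 1 + 1 = τ by omega, hτg, hXp]; omega)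
      rw [show τ - 1 + 1 = τ by omega, hYτ0] at this
      exact this.symm
    have hp1 : 1 ≤ τ - 1 := by
      by_contra h
      have : τ - 1 = 0 := by omega
      rw [this, hX0] at hXp; omega
    have hparp := parity_apply hs (show τ - 1 ≤ n by omega)
    rw [hXp, hYp, add_zero] at hparp
    have hp2 : (τ - 1) % 2 = 0 := by omega
    obtain ⟨u, hτu, hun, hXu⟩ := exists_return_of_visit hω hp1 (by omega) hp2 hYp fun i hi => by
      rw [hXp]; have := hlt i (by omega); omega
    rw [hXp] at hXu
    have hu2 : τ < u := by
      by_contra h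
      have : u = τ := by omega
      rw [this, hτg] at hXu; omega
    obtain ⟨i, hi1, hiu, hXi, hXi1⟩ := exists_descent hbw hu2 hun (c := g - 1) (by rw [hτg]; omega) hXu
    have hiτ : i ≠ τ := fun h => by
      rw [h] at hXi1
      rcases step_from_wall hw hτn' hYτ0 with ⟨hx, -⟩ | ⟨hx, -⟩ <;> rw [hx, hτg] at hXi1 <;> omega
    refine ⟨i, by omega, lt_of_le_of_ne (hhp i (by omega)) fun hY => hiτ ?_, by rw [hXi]; ring⟩
    exact hinj (show i ∈ {m | m ≤ n} by simp; omega) (show τ ∈ {m | m ≤ n} from hτn)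
      (site_ext_vb (by rw [hXi, hτg]; ring) (by rw [hY, hYτ0]))

/-- **A sub-wall point in the first two columns.** An irreducible positive wall bridge of length `n ≥ 4` has a point
strictly below the wall in a column `≤ 2`: either it dives at `(1, 0)`, or `(2, 0)` is a visit and non-renewal
forces a later return to a column `≤ 2`, below the wall by wall order.
[cite: MadrasSlade1993, §4.2, Definition 4.2.1 (irreducible bridges);
BeatonBousquetMelouDeGierDuminilCopinGuttmann2014, §3.1 (arXiv v5 p. 8)] -/
theorem exists_subwall_le_two (hω : ω ∈ ipwb n) (hn : 4 ≤ n) : ∃ s, s ≤ n ∧ ω s 1 < 0 ∧ ω s 0 ≤ 2 := by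
  obtain ⟨hp, hn1, hirr⟩ := mem_ipwb.1 hω
  obtain ⟨hw, hb⟩ := mem_pwb.1 hp
  obtain ⟨ha, hwb⟩ := mem_wbr.1 hw
  obtain ⟨hh, -, -⟩ := mem_archs.1 ha
  obtain ⟨hs, hhp⟩ := mem_hpw.1 hh
  obtain ⟨h0, -, hbw, -⟩ := mem_saws_iff.1 hs
  have hX0 : ω 0 0 = 0 := by rw [h0]; rfl
  have hY0 : ω 0 1 = 0 := by rw [h0]; rfl
  have h1 : ω 1 0 = 1 ∧ ω 1 1 = 0 := by
    rcases step_from_wall hw (show 0 < n by omega) hY0 with ⟨hx, hy⟩ | ⟨hx, -⟩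
    · simp only [zero_add] at hx hy
      exact ⟨by rw [hx, hX0]; rfl, hy⟩
    · simp only [zero_add] at hx
      have := (hb 1 le_rfl hn1).1
      rw [hx] at this
      exact absurd this (lt_irrefl _)
  rcases step_from_wall hw (show 1 < n by omega) h1.2 with ⟨hx, hy⟩ | ⟨hx, hy⟩
  · -- `(2, 0)` is a visit at time `2`
    rw [h1.1] at hx
    obtain ⟨u, h2u, hun, hXu⟩ := exists_return_of_visit hω (t := 2) (by norm_num) (by omega) (by norm_num) hy
      fun i hi => by
        interval_cases i
        · rw [hX0, hx]; norm_num
        · rw [h1.1, hx]; norm_num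
        · exact le_rfl
    rw [hx] at hXu
    refine ⟨u, hun, lt_of_le_of_ne (hhp u hun) fun hY => ?_, by norm_num at hXu ⊢; exact hXu⟩
    have := apply_lt_apply_of_wall hw h2u hun hy hY
    rw [hx] at this
    norm_num at this hXu
    omega
  · exact ⟨2, by omega, by rw [hy]; norm_num, by rw [hx, h1.1]; norm_num⟩


/-! ## §3 Cuts: the last wall time before a sub-wall time, straddling, crossings below the wall -/

/-- **The last wall time before a sub-wall time.** For a time `s ≤ n` strictly below the wall let
`d = Nat.findGreatest (Y_· = 0) s` be the last time `≤ s` on the wall.  Then `d < s`, `Y_d = 0`, the step from `d`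
is a dive (`Y_{d+1} = −1`), and no time in `(d, s]` is on the wall.
[cite: MadrasSlade1993, §3.1, Definition 3.1.2 (half-space walks); EntingJensen2009, §7.4.2, Fig. 7.10] -/
theorem findGreatest_wall_spec (hw : ω ∈ wbr n) {s : ℕ} (hsn : s ≤ n) (hYs : ω s 1 < 0) :
    Nat.findGreatest (fun t => ω t 1 = 0) s < s ∧ ω (Nat.findGreatest (fun t => ω t 1 = 0) s) 1 = 0 ∧
      ω (Nat.findGreatest (fun t => ω t 1 = 0) s + 1) 1 = -1 ∧
      ∀ t, Nat.findGreatest (fun t => ω t 1 = 0) s < t → t ≤ s → ω t 1 ≠ 0 := by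
  obtain ⟨ha, -⟩ := mem_wbr.1 hw
  obtain ⟨hh, -, -⟩ := mem_archs.1 ha
  obtain ⟨hs, -⟩ := mem_hpw.1 hh
  obtain ⟨h0, -, -, -⟩ := mem_saws_iff.1 hs
  have hY0 : ω 0 1 = 0 := by rw [h0]; rfl
  set d := Nat.findGreatest (fun t => ω t 1 = 0) s with hd
  have hYd : ω d 1 = 0 := Nat.findGreatest_spec (P := fun t => ω t 1 = 0) (Nat.zero_le s) hY0
  have hds : d ≤ s := Nat.findGreatest_le s
  have hgr : ∀ t, d < t → t ≤ s → ω t 1 ≠ 0 := fun t h1 h2 =>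
    Nat.findGreatest_is_greatest (P := fun t => ω t 1 = 0) h1 h2
  have hlt : d < s := lt_of_le_of_ne hds fun h => by rw [h] at hYd; rw [hYd] at hYs; exact lt_irrefl _ hYs
  refine ⟨hlt, hYd, ?_, hgr⟩
  rcases step_from_wall hw (show d < n by omega) hYd with ⟨-, hy⟩ | ⟨-, hy⟩
  · exact absurd hy (hgr (d + 1) (by omega) (by omega))
  · exact hy

/-- **Bodies do not straddle an uncrossed cut.** Suppose no horizontal step below the wall crosses the cut between
the columns `c` and `c + 1`.  If `s ≤ n` is a time at column `c + 1`, `u ≤ n` any time, and the walk is off the wall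
on `(d, s]` and on `(d, u]` for a common earlier time `d`, then `X_u ≥ c + 1`: a passage from one side of the cut to
the other inside `(d, max (s,u)]` would be a crossing below the wall.
[cite: MadrasSlade1993, §3.1, Definition 3.1.2 (half-space walks); EntingJensen2009, §7.4.2, Fig. 7.10] -/
theorem le_apply_of_no_subwall_crossing (hw : ω ∈ wbr n) {c : ℤ}
    (hno : ∀ i < n, ω (i + 1) 1 = ω i 1 → ω i 1 < 0 → min (ω i 0) (ω (i + 1) 0) ≠ c)
    {d s u : ℕ} (hds : d < s) (hsn : s ≤ n) (hXs : ω s 0 = c + 1) (hdu : d < u) (hun : u ≤ n)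
    (hgs : ∀ t, d < t → t ≤ s → ω t 1 ≠ 0) (hgu : ∀ t, d < t → t ≤ u → ω t 1 ≠ 0) : c + 1 ≤ ω u 0 := by
  obtain ⟨ha, -⟩ := mem_wbr.1 hw
  obtain ⟨hh, -, -⟩ := mem_archs.1 ha
  obtain ⟨hs, hhp⟩ := mem_hpw.1 hh
  obtain ⟨-, -, hbw, -⟩ := mem_saws_iff.1 hs
  by_contra hlt
  rw [not_le] at hlt
  rcases lt_trichotomy u s with hus | hus | hus
  · obtain ⟨i, hi1, hi2, hXi, hXi1⟩ := exists_ascent hbw hus hsn (c := c) (by omega) (by rw [hXs]; omega)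
    have hY := apply_one_eq_of_apply_zero_ne hbw (i := i) (by omega) (by rw [hXi, hXi1]; omega)
    have hYi : ω i 1 ≠ 0 := hgs i (by omega) (by omega)
    exact hno i (by omega) hY (lt_of_le_of_ne (hhp i (by omega)) hYi) (by rw [hXi, hXi1]; omega)
  · rw [hus, hXs] at hlt; omega
  · obtain ⟨i, hi1, hi2, hXi, hXi1⟩ := exists_descent hbw hus hun (c := c) (by rw [hXs]; omega) (by omega)
    have hY := apply_one_eq_of_apply_zero_ne hbw (i := i) (by omega) (by rw [hXi, hXi1]; omega)
    have hYi : ω i 1 ≠ 0 := hgu i (by omega) (by omega)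
    exact hno i (by omega) hY (lt_of_le_of_ne (hhp i (by omega)) hYi) (by rw [hXi, hXi1]; omega)

/-- **An unused cut is crossed below the wall.** If no wall step starts at the column `c` (`0 ≤ c < X_n`), some
horizontal step below the wall crosses the cut between the columns `c` and `c + 1`: the walk gets from column `0` to
column `X_n`, and a crossing on the wall would be a wall step from `(c, 0)`.
[cite: MadrasSlade1993, §1.2, Definition 1.2.4 (bridges); EntingJensen2009, §7.4.2, Fig. 7.10] -/
theorem exists_subwall_crossing_of_unused (hw : ω ∈ wbr n) {c : ℤ} (hc0 : 0 ≤ c) (hcX : c + 1 ≤ ω n 0)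
    (hun : ∀ w < n, ω w 1 = 0 → ω (w + 1) 1 = 0 → ω w 0 ≠ c) :
    ∃ i, i < n ∧ ω (i + 1) 1 = ω i 1 ∧ ω i 1 < 0 ∧ min (ω i 0) (ω (i + 1) 0) = c := by
  obtain ⟨ha, -⟩ := mem_wbr.1 hw
  obtain ⟨hh, -, -⟩ := mem_archs.1 ha
  obtain ⟨hs, hhp⟩ := mem_hpw.1 hh
  obtain ⟨h0, -, hbw, -⟩ := mem_saws_iff.1 hs
  have hX0 : ω 0 0 = 0 := by rw [h0]; rfl
  have hn : 0 < n := Nat.pos_of_ne_zero fun h => by subst h; rw [hX0] at hcX; omega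
  obtain ⟨i, -, hin, hXi, hXi1⟩ := exists_ascent hbw hn le_rfl (c := c) (by rw [hX0]; exact hc0) (by omega)
  have hY := apply_one_eq_of_apply_zero_ne hbw hin (by rw [hXi, hXi1]; omega)
  have hYi : ω i 1 ≠ 0 := fun h => hun i hin h (by rw [hY, h]) hXi
  exact ⟨i, hin, hY, lt_of_le_of_ne (hhp i hin.le) hYi, by rw [hXi, hXi1]; omega⟩

/-- **A used cut crossed below the wall is crossed there twice.** Let `w` be a wall step (from `(c, 0)` to
`(c + 1, 0)`, `c = X_w`) and suppose a horizontal step `s` below the wall crosses the same cut.  Then the cut is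
crossed below the wall by a LEFT step `l` and by a RIGHT step `r`: between two right crossings there is a left one,
around a left crossing there are two right ones, at most one of which is `w`; every crossing other than `w` is below
the wall (wall steps go right, and `(c, 0)` is visited once).
[cite: MadrasSlade1993, §1.2, Definition 1.2.4 (bridges), §3.1, Definition 3.1.2 (half-space walks);
EntingJensen2009, §7.4.2, Fig. 7.10] -/
theorem exists_two_subwall_crossings_of_used (hw : ω ∈ wbr n) {w s : ℕ} (hwn : w < n) (hYw : ω w 1 = 0)
    (hYw1 : ω (w + 1) 1 = 0) (hsn : s < n) (hHs : ω (s + 1) 1 = ω s 1) (hYs : ω s 1 < 0)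
    (hκ : min (ω s 0) (ω (s + 1) 0) = ω w 0) :
    ∃ l r, l < n ∧ r < n ∧ (ω (l + 1) 1 = ω l 1 ∧ ω l 1 < 0) ∧ (ω (r + 1) 1 = ω r 1 ∧ ω r 1 < 0) ∧
      ω l 0 = ω w 0 + 1 ∧ ω (l + 1) 0 = ω w 0 ∧ ω r 0 = ω w 0 ∧ ω (r + 1) 0 = ω w 0 + 1 := by
  obtain ⟨ha, hwb⟩ := mem_wbr.1 hw
  obtain ⟨hh, -, -⟩ := mem_archs.1 ha
  obtain ⟨hs, hhp⟩ := mem_hpw.1 hh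
  obtain ⟨h0, -, hbw, hinj⟩ := mem_saws_iff.1 hs
  have hY0 : ω 0 1 = 0 := by rw [h0]; rfl
  have hXw1 : ω (w + 1) 0 = ω w 0 + 1 := apply_succ_eq_of_wall_step hw hwn hYw hYw1
  have hcX : ω w 0 + 1 ≤ ω n 0 := by rw [← hXw1]; exact (hwb (w + 1) (by omega)).2
  -- a left crossing of the cut is below the wall
  have hleft : ∀ i < n, ω i 0 = ω w 0 + 1 → ω (i + 1) 0 = ω w 0 → ω (i + 1) 1 = ω i 1 ∧ ω i 1 < 0 := by
    intro i hin hXi hXi1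
    have hY := apply_one_eq_of_apply_zero_ne hbw hin (by rw [hXi, hXi1]; omega)
    refine ⟨hY, lt_of_le_of_ne (hhp i hin.le) fun hYi => ?_⟩
    rcases step_from_wall hw hin hYi with ⟨hx, -⟩ | ⟨hx, -⟩ <;> rw [hx, hXi] at hXi1 <;> omega
  -- a right crossing other than `w` is below the wall
  have hright : ∀ i < n, i ≠ w → ω i 0 = ω w 0 → ω (i + 1) 0 = ω w 0 + 1 →
      ω (i + 1) 1 = ω i 1 ∧ ω i 1 < 0 := by
    intro i hin hiw hXi hXi1
    have hY := apply_one_eq_of_apply_zero_ne hbw hin (by rw [hXi, hXi1]; omega)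
    refine ⟨hY, lt_of_le_of_ne (hhp i hin.le) fun hYi => hiw ?_⟩
    exact hinj (show i ∈ {m | m ≤ n} by simp; omega) (show w ∈ {m | m ≤ n} by simp; omega)
      (site_ext_vb hXi (by rw [hYi, hYw]))
  -- between two right crossings there is a left crossing
  have hbetween : ∀ t₁ t₂, t₁ < t₂ → t₂ < n → ω (t₁ + 1) 0 = ω w 0 + 1 → ω t₂ 0 = ω w 0 →
      ∃ l, t₁ < l ∧ l < t₂ ∧ ω l 0 = ω w 0 + 1 ∧ ω (l + 1) 0 = ω w 0 := by
    intro t₁ t₂ h12 h2n hX1 hX2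
    have h12' : t₁ + 1 < t₂ := lt_of_le_of_ne h12 fun h => by rw [h] at hX1; rw [hX1] at hX2; omega
    obtain ⟨l, hl1, hl2, hXl, hXl1⟩ := exists_descent hbw h12' h2n.le (c := ω w 0) (by rw [hX1]; omega)
      (by rw [hX2])
    exact ⟨l, by omega, hl2, by rw [hXl], hXl1⟩
  have hsw : s ≠ w := fun h => by rw [h, hYw] at hYs; exact lt_irrefl _ hYs
  rcases apply_zero_succ_of_apply_one_eq hbw hsn hHs with hR | hL
  · -- `s` is a right crossing: `X_s = c`
    have hXs : ω s 0 = ω w 0 := by rw [hR] at hκ; omega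
    have hXs1 : ω (s + 1) 0 = ω w 0 + 1 := by rw [hR, hXs]
    rcases lt_or_gt_of_ne hsw with h | h
    · obtain ⟨l, hl1, hl2, hXl, hXl1⟩ := hbetween s w h hwn hXs1 rfl
      exact ⟨l, s, by omega, hsn, hleft l (by omega) hXl hXl1, ⟨hHs, hYs⟩, hXl, hXl1, hXs, hXs1⟩
    · obtain ⟨l, hl1, hl2, hXl, hXl1⟩ := hbetween w s h hsn hXw1 hXs
      exact ⟨l, s, by omega, hsn, hleft l (by omega) hXl hXl1, ⟨hHs, hYs⟩, hXl, hXl1, hXs, hXs1⟩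
  · -- `s` is a left crossing: `X_s = c + 1`
    have hXs1 : ω (s + 1) 0 = ω w 0 := by rw [hL] at hκ; omega
    have hXs : ω s 0 = ω w 0 + 1 := by rw [hL] at hXs1; omega
    have hs0 : 0 < s := Nat.pos_of_ne_zero fun h => by rw [h, hY0] at hYs; exact lt_irrefl _ hYs
    have hs1n : s + 1 < n := lt_of_le_of_ne hsn fun h => by rw [h] at hXs1; rw [hXs1] at hcX; omega
    obtain ⟨r₁, -, hr₁s, hXr₁, hXr₁1⟩ := exists_ascent hbw hs0 hsn.le (c := ω w 0) (hwb w hwn.le).1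
      (by rw [hXs]; omega)
    obtain ⟨r₂, hsr₂, hr₂n, hXr₂, hXr₂1⟩ := exists_ascent hbw hs1n le_rfl (c := ω w 0) (by rw [hXs1]) hcX
    by_cases h1 : r₁ = w
    · have h2 : r₂ ≠ w := fun h => by omega
      exact ⟨s, r₂, hsn, hr₂n, ⟨hHs, hYs⟩, hright r₂ hr₂n h2 hXr₂ hXr₂1, hXs, hXs1, hXr₂, hXr₂1⟩
    · exact ⟨s, r₁, hsn, by omega, ⟨hHs, hYs⟩, hright r₁ (by omega) h1 hXr₁ hXr₁1, hXs, hXs1, hXr₁, hXr₁1⟩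


/-! ## §4 Step bookkeeping; separating cuts are few -/

/-- **Step bookkeeping.** The horizontal steps of a wall bridge are its `2v` wall steps and its horizontal steps
strictly below the wall: `#R + #L = 2v + #{t < n : Y_{t+1} = Y_t < 0}`.
[cite: BeatonBousquetMelouDeGierDuminilCopinGuttmann2014, §3.1 (arXiv v5 p. 8: surface visits);
EntingJensen2009, §7.4.2, Fig. 7.10] -/
theorem card_stepsR_add_card_stepsL_eq (hw : ω ∈ wbr n) :
    #(stepsR n ω) + #(stepsL n ω) =
      2 * visits n ω + #((range n).filter fun t => ω (t + 1) 1 = ω t 1 ∧ ω t 1 < 0) := by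
  classical
  obtain ⟨ha, -⟩ := mem_wbr.1 hw
  obtain ⟨hh, -, -⟩ := mem_archs.1 ha
  obtain ⟨hs, hhp⟩ := mem_hpw.1 hh
  obtain ⟨-, -, hbw, -⟩ := mem_saws_iff.1 hs
  rw [← card_wallSteps_eq_two_mul_visits hw]
  obtain ⟨HZ, hHZ⟩ : ∃ HZ : Finset ℕ, HZ = (range n).filter fun t => ω (t + 1) 1 = ω t 1 := ⟨_, rfl⟩
  have hR : stepsR n ω = HZ.filter fun t => ω (t + 1) 0 = ω t 0 + 1 := by
    ext t
    simp only [stepsR, hHZ, Finset.mem_filter, Finset.mem_range]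
    constructor
    · rintro ⟨ht, hx⟩
      exact ⟨⟨ht, apply_one_eq_of_apply_zero_ne hbw ht (by rw [hx]; omega)⟩, hx⟩
    · rintro ⟨⟨ht, -⟩, hx⟩
      exact ⟨ht, hx⟩
  have hL : stepsL n ω = HZ.filter fun t => ¬ ω (t + 1) 0 = ω t 0 + 1 := by
    ext t
    simp only [stepsL, hHZ, Finset.mem_filter, Finset.mem_range]
    constructor
    · rintro ⟨ht, hx⟩
      exact ⟨⟨ht, apply_one_eq_of_apply_zero_ne hbw ht (by rw [hx]; omega)⟩, by rw [hx]; omega⟩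
    · rintro ⟨⟨ht, hy⟩, hx⟩
      rcases apply_zero_succ_of_apply_one_eq hbw ht hy with h | h
      · exact absurd h hx
      · exact ⟨ht, h⟩
  have hW : ((range n).filter fun t => ω t 1 = 0 ∧ ω (t + 1) 1 = 0) = HZ.filter fun t => ω t 1 = 0 := by
    ext t
    simp only [hHZ, Finset.mem_filter, Finset.mem_range]
    constructor
    · rintro ⟨ht, hy, hy'⟩
      exact ⟨⟨ht, by rw [hy, hy']⟩, hy⟩
    · rintro ⟨⟨ht, hy'⟩, hy⟩
      exact ⟨ht, hy, by rw [hy', hy]⟩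
  have hS : ((range n).filter fun t => ω (t + 1) 1 = ω t 1 ∧ ω t 1 < 0) = HZ.filter fun t => ¬ ω t 1 = 0 := by
    ext t
    simp only [hHZ, Finset.mem_filter, Finset.mem_range]
    constructor
    · rintro ⟨ht, hy', hy⟩
      exact ⟨⟨ht, hy'⟩, hy.ne⟩
    · rintro ⟨⟨ht, hy'⟩, hy⟩
      exact ⟨ht, hy', lt_of_le_of_ne (hhp t ht.le) hy⟩
  rw [hR, hL, hW, hS, Finset.card_filter_add_card_filter_not, Finset.card_filter_add_card_filter_not]

/-- **SEPARATING CUTS ARE FEW.** In an irreducible positive wall bridge of length `n ≥ 4`, the cuts `c + 1/2` with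
`2 ≤ c ≤ X_n − 2` that are not crossed by any horizontal step strictly below the wall number at most `r − 1`, where
`r = #{t < n : Y_t = 0, Y_{t+1} = −1}` is the number of dives: `c ↦` (the last wall time before a sub-wall point of
column `c + 1`, which exists by `exists_subwall_at`) is an injection into the dives (`le_apply_of_no_subwall_crossing`)
missing the dive that precedes a sub-wall point of column `≤ 2` (`exists_subwall_le_two`).
[cite: MadrasSlade1993, §4.2, Definition 4.2.1 and the remark before (4.2.21) (p. 94: irreducible bridges), §3.1,
Definition 3.1.2 (half-space walks); HammersleyTorrieWhittington1982, §2 (surface bridges);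
EntingJensen2009, §7.4.2, Fig. 7.10] -/
theorem card_uncrossed_cuts_add_one_le_card_dives (hω : ω ∈ ipwb n) (hn : 4 ≤ n) :
    #((Finset.Icc (2 : ℤ) (ω n 0 - 2)).filter fun c =>
        ∀ i < n, ω (i + 1) 1 = ω i 1 → ω i 1 < 0 → min (ω i 0) (ω (i + 1) 0) ≠ c) + 1 ≤
      #((range n).filter fun t => ω t 1 = 0 ∧ ω (t + 1) 1 = -1) := by
  classical
  obtain ⟨hp, -, -⟩ := mem_ipwb.1 hω
  obtain ⟨hw, -⟩ := mem_pwb.1 hp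
  obtain ⟨BadC, hBadC⟩ : ∃ BadC : Finset ℤ, BadC = (Finset.Icc (2 : ℤ) (ω n 0 - 2)).filter fun c =>
      ∀ i < n, ω (i + 1) 1 = ω i 1 → ω i 1 < 0 → min (ω i 0) (ω (i + 1) 0) ≠ c := ⟨_, rfl⟩
  obtain ⟨DV, hDV⟩ : ∃ DV : Finset ℕ, DV = (range n).filter fun t => ω t 1 = 0 ∧ ω (t + 1) 1 = -1 := ⟨_, rfl⟩
  rw [← hBadC, ← hDV]
  have hBmem : ∀ c ∈ BadC, (2 ≤ c ∧ c ≤ ω n 0 - 2) ∧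
      ∀ i < n, ω (i + 1) 1 = ω i 1 → ω i 1 < 0 → min (ω i 0) (ω (i + 1) 0) ≠ c := by
    intro c hc
    rw [hBadC, Finset.mem_filter, Finset.mem_Icc] at hc
    exact hc
  have hcov : ∀ c ∈ BadC, ∃ s : ℕ, s ≤ n ∧ ω s 1 < 0 ∧ ω s 0 = c + 1 := fun c hc =>
    exists_subwall_at hω (g := c + 1) (by have := (hBmem c hc).1; omega)
      (by have := (hBmem c hc).1; omega)
  choose! sf hsf using hcov
  obtain ⟨s₀, hs₀n, hYs₀, hXs₀⟩ := exists_subwall_le_two hω hn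
  obtain ⟨hd₀s, hYd₀, hYd₀1, hgap₀⟩ := findGreatest_wall_spec hw hs₀n hYs₀
  obtain ⟨d₀, hd₀⟩ : ∃ d₀ : ℕ, d₀ = Nat.findGreatest (fun t => ω t 1 = 0) s₀ := ⟨_, rfl⟩
  rw [← hd₀] at hd₀s hYd₀ hYd₀1 hgap₀
  have hd₀DV : d₀ ∈ DV := by
    rw [hDV, Finset.mem_filter, Finset.mem_range]; exact ⟨by omega, hYd₀, hYd₀1⟩
  have hφ : ∀ c ∈ BadC, Nat.findGreatest (fun t => ω t 1 = 0) (sf c) ∈ DV.erase d₀ := by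
    intro c hc
    obtain ⟨hsn, hYs, hXs⟩ := hsf c hc
    obtain ⟨hds, hYd, hYd1, hgap⟩ := findGreatest_wall_spec hw hsn hYs
    rw [Finset.mem_erase, hDV, Finset.mem_filter, Finset.mem_range]
    refine ⟨fun he => ?_, by omega, hYd, hYd1⟩
    rw [he] at hds hgap
    have h1 := le_apply_of_no_subwall_crossing hw (hBmem c hc).2 hds hsn hXs hd₀s hs₀n hgap hgap₀
    have h2 := (hBmem c hc).1
    omega
  have hinjφ : Set.InjOn (fun c => Nat.findGreatest (fun t => ω t 1 = 0) (sf c)) ↑BadC := by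
    intro c hc c' hc' he
    have hc := Finset.mem_coe.1 hc
    have hc' := Finset.mem_coe.1 hc'
    have he : Nat.findGreatest (fun t => ω t 1 = 0) (sf c) = Nat.findGreatest (fun t => ω t 1 = 0) (sf c') :=
      he
    obtain ⟨hsn, hYs, hXs⟩ := hsf c hc
    obtain ⟨hds, -, -, hgap⟩ := findGreatest_wall_spec hw hsn hYs
    obtain ⟨hsn', hYs', hXs'⟩ := hsf c' hc'
    obtain ⟨hds', -, -, hgap'⟩ := findGreatest_wall_spec hw hsn' hYs'
    rw [he] at hds hgap
    have h1 := le_apply_of_no_subwall_crossing hw (hBmem c hc).2 hds hsn hXs hds' hsn' hgap hgap'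
    have h2 := le_apply_of_no_subwall_crossing hw (hBmem c' hc').2 hds' hsn' hXs' hds hsn hgap' hgap
    rw [hXs'] at h1
    rw [hXs] at h2
    omega
  have hle := Finset.card_le_card_of_injOn (fun c => Nat.findGreatest (fun t => ω t 1 = 0) (sf c))
    (fun c hc => Finset.mem_coe.2 (hφ c (Finset.mem_coe.1 hc))) hinjφ
  rw [Finset.card_erase_of_mem hd₀DV] at hle
  have := Finset.card_pos.2 ⟨d₀, hd₀DV⟩
  omega

end Literature.Probability.RandomPlanarGeometry.SAW.HexBW.Wall
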